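import Summits.CriticalPhenomena.PercolationContinuityZ3.Theorems.PercNearOneGluingNoHeavyLowerTailCILSetStarWitnesses
import Summits.CriticalPhenomena.PercolationContinuityZ3.Theorems.PercNearOneGluingNoHeavyLowerTailCILTwoGate
import Summits.CriticalPhenomena.PercolationContinuityZ3.Theorems.PercNearOneGluingNoHeavyLowerTailQuantitativeLonelierMember
import HarnessLib

/-!
# `NoHeavyLowerTail` (stmt-CriticalPhenomena-4575) — the induction STEP from per-class references with QLM deficiencies
# (the Lean socket of the "QI" certificate)

Support file (prover `prim-hp-5`, hull-port cell, blob-quotient technique; `--supports stmt-CriticalPhenomena-4575`).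
No definitions, no named facts, no sorries.

Notation of `…CILSetStarTools` / `…CILSetStarWitnesses`: `μ = prodBernoulli w`, relays `A`, level `j`, observer set `S`
disjoint from `A`, `ξ(ω) = ω ∩ {e | ∀ v ∈ S, v ∉ e}` ("`K = H − S`"), gate classes `{Γ = Y}` with weights `q(Y)`, and for a
class `Y` and a vertex `x`: `ℓ_Y(x) = μ(x ≁' Y, 1 ≤ |π'(Y)| ≤ j)`, `r_Y(x) = μ(x ≁' Y, |π'(x)| ≤ j)`,
`b_Y(x) = μ(x ~' Y, |π'(Y)| ≤ j)`, `J^Y(x) = r_Y(x) + b_Y(x)` (lightness with `Y` glued), `I_K(x) = μ{|π'(x)| ≤ j}`.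

By the flat expansion `μ(RS) − μ(LS) = Σ_Y q(Y)·(r_Y(c) − ℓ_Y(c))` and the witness shift
`(r_Y(c) − ℓ_Y(c)) − (r_Y(x) − ℓ_Y(x)) = J^Y(c) − J^Y(x)`, any lower bound `r_Y(x) − ℓ_Y(x) ≥ −d(Y)` for a reference `x = x_Y`
bounds the class term below by `J^Y(c) − J^Y(x_Y) − d(Y)`.  The quantitative lonelier-member lemma
(`CutObserver.observerSet_le_add_posPart`, file `…QuantitativeLonelierMember`) supplies `d(Y) = (I_K(y) − I_K(x_Y))⁺` for
EVERY member `y ∈ Y` and EVERY reference `x_Y` — no feasibility ("certification") of the reference is needed.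

* `SetStar.setCS_of_classDeficiencies` — the socket with arbitrary per-class slacks `d(Y)`.
* `SetStar.setCS_of_classMembers` — the QLM instantiation: given, for each nonempty class, a reference relay `x_Y ∈ A` and a
  member `y_Y ∈ Y`, the inequality
  `q(∅)·I_K(c) + Σ_{∅ ≠ Y} q(Y)·(J^Y(c) − J^Y(x_Y) − (I_K(y_Y) − I_K(x_Y))⁺) ≥ 0` implies `CS_w(S, c)`.
  With `x_Y = c` the class term is `−min`-type QLM slack alone; with `x_Y` a champion of `K` and `Y ∋` a relay no lighter
  than it the slack vanishes (BHK); the induction hypothesis of `setCS_of_step` (CS for champions of `K` at all-Steiner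
  classes) enters through `setCS_of_classDeficiencies` with `d(Y) = 0` for those classes.

Numerics (this seat, lab/bqi*.py, kit j047230, ttrl request `qi-coverage-step-certificate`): the certificate
"per class, the best of {QLM-shift over all relays, champ(K)-shift}" (B_QI) is ≥ 0 on all six published ≥3-gate
counterexamples to the bounded-depth reference rules B0/B1/B2/(ML*)/FR of the crux notes (BLOBQUOTIENT.md §17–§21) and in
≈ 1 000 random + 70 adversarially climbed instances (n ≤ 8), equality only at ties — the typed candidate "QI-coverage".
-/

noncomputable section

namespace Summit.CriticalPhenomena.PercolationContinuityZ3.Theorems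

open MeasureTheory Set Literature.Probability.LatticeModels Literature.Probability.Percolation
open scoped Classical BigOperators

variable {n : ℕ}

namespace CutObserver

namespace SetStar

open TwoGate in
/-- **Set-champion stability from per-gate-class references WITH DEFICIENCIES.**  As
`SetStar.setCS_of_classWitnesses`, but the reference relay `x_Y` of a class need only satisfy `CS_K(Y, x_Y)` up to an additive
slack `d(Y)` (`ℓ_Y(x_Y) ≤ r_Y(x_Y) + d(Y)`), which is then subtracted in the averaged inequality:
`q(∅)·I_K(c) + Σ_{∅ ≠ Y ∈ 𝒴} q(Y)·(J^Y(c) − J^Y(x_Y) − d(Y)) ≥ 0` implies `CS_w(S, c)`.  The slack of a class is supplied,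
for ANY reference relay, by the quantitative lonelier-member lemma (`setCS_of_classMembers` below). [folklore] -/
theorem setCS_of_classDeficiencies (w : Sym2 (Fin n) → unitInterval) (A S : Finset (Fin n)) (c : Fin n) (j : ℕ)
    (hSA : Disjoint S A) (hcA : c ∈ A) (𝒴 : Finset (Finset (Fin n)))
    (h𝒴 : (prodBernoulli w).real
      {ω : BondConfig (Fin n) | (Finset.univ.filter fun u => u ∉ S ∧ ∃ v ∈ S, s(u, v) ∈ ω) ∉ 𝒴} = 0)
    (x : Finset (Fin n) → Fin n) (hxA : ∀ Y ∈ 𝒴, x Y ∈ A) (d : Finset (Fin n) → ℝ)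
    (hW : ∀ Y ∈ 𝒴, Y.Nonempty →
      (prodBernoulli w).real {ω : BondConfig (Fin n) |
          (∀ u ∈ Y, ¬ (openGraph (ω ∩ {e | ∀ v ∈ S, v ∉ e})).Reachable (x Y) u) ∧
            1 ≤ (A.filter fun b => ∃ u ∈ Y, (openGraph (ω ∩ {e | ∀ v ∈ S, v ∉ e})).Reachable u b).card ∧
            (A.filter fun b => ∃ u ∈ Y, (openGraph (ω ∩ {e | ∀ v ∈ S, v ∉ e})).Reachable u b).card ≤ j} ≤
        (prodBernoulli w).real {ω : BondConfig (Fin n) |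
          (∀ u ∈ Y, ¬ (openGraph (ω ∩ {e | ∀ v ∈ S, v ∉ e})).Reachable (x Y) u) ∧
            (A.filter fun b => (openGraph (ω ∩ {e | ∀ v ∈ S, v ∉ e})).Reachable (x Y) b).card ≤ j} + d Y)
    (havg : 0 ≤ ∑ Y ∈ 𝒴,
      (prodBernoulli w).real
          {ω : BondConfig (Fin n) | (Finset.univ.filter fun u => u ∉ S ∧ ∃ v ∈ S, s(u, v) ∈ ω) = Y} *
        (if Y = ∅ then
          (prodBernoulli w).real {ω : BondConfig (Fin n) |
            (A.filter fun b => (openGraph (ω ∩ {e | ∀ v ∈ S, v ∉ e})).Reachable c b).card ≤ j}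
         else
          (((prodBernoulli w).real {ω : BondConfig (Fin n) |
              (∀ u ∈ Y, ¬ (openGraph (ω ∩ {e | ∀ v ∈ S, v ∉ e})).Reachable c u) ∧
                (A.filter fun b => (openGraph (ω ∩ {e | ∀ v ∈ S, v ∉ e})).Reachable c b).card ≤ j} +
            (prodBernoulli w).real {ω : BondConfig (Fin n) |
              (∃ u ∈ Y, (openGraph (ω ∩ {e | ∀ v ∈ S, v ∉ e})).Reachable c u) ∧
                (A.filter fun b => ∃ u ∈ Y, (openGraph (ω ∩ {e | ∀ v ∈ S, v ∉ e})).Reachable u b).card ≤ j}) -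
          ((prodBernoulli w).real {ω : BondConfig (Fin n) |
              (∀ u ∈ Y, ¬ (openGraph (ω ∩ {e | ∀ v ∈ S, v ∉ e})).Reachable (x Y) u) ∧
                (A.filter fun b => (openGraph (ω ∩ {e | ∀ v ∈ S, v ∉ e})).Reachable (x Y) b).card ≤ j} +
            (prodBernoulli w).real {ω : BondConfig (Fin n) |
              (∃ u ∈ Y, (openGraph (ω ∩ {e | ∀ v ∈ S, v ∉ e})).Reachable (x Y) u) ∧
                (A.filter fun b => ∃ u ∈ Y, (openGraph (ω ∩ {e | ∀ v ∈ S, v ∉ e})).Reachable u b).card ≤ j}) -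
            d Y)))
    : (prodBernoulli w).real {ω : BondConfig (Fin n) | (∀ y ∈ S, ω ∉ openConn c y) ∧
        1 ≤ (A.filter fun b => ∃ y ∈ S, ω ∈ openConn y b).card ∧
        (A.filter fun b => ∃ y ∈ S, ω ∈ openConn y b).card ≤ j} ≤
      (prodBernoulli w).real {ω : BondConfig (Fin n) | (∀ y ∈ S, ω ∉ openConn c y) ∧
        (A.filter fun b => ω ∈ openConn c b).card ≤ j} := by
  haveI : IsProbabilityMeasure (prodBernoulli w) := inferInstance
  set μ := prodBernoulli w with hμ
  have hcS : c ∉ S := fun h => Finset.disjoint_left.1 hSA h hcA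
  set LS := {ω : BondConfig (Fin n) | (∀ y ∈ S, ω ∉ openConn c y) ∧
    1 ≤ (A.filter fun b => ∃ y ∈ S, ω ∈ openConn y b).card ∧
    (A.filter fun b => ∃ y ∈ S, ω ∈ openConn y b).card ≤ j} with hLS
  set RS := {ω : BondConfig (Fin n) | (∀ y ∈ S, ω ∉ openConn c y) ∧
    (A.filter fun b => ω ∈ openConn c b).card ≤ j} with hRS
  set q : Finset (Fin n) → ℝ := fun Y =>
    μ.real {ω : BondConfig (Fin n) | (Finset.univ.filter fun u => u ∉ S ∧ ∃ v ∈ S, s(u, v) ∈ ω) = Y} with hq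
  set ℓ : Finset (Fin n) → Fin n → ℝ := fun Y t => μ.real {ω : BondConfig (Fin n) |
    (∀ u ∈ Y, ¬ (openGraph (ω ∩ {e | ∀ v ∈ S, v ∉ e})).Reachable t u) ∧
      1 ≤ (A.filter fun b => ∃ u ∈ Y, (openGraph (ω ∩ {e | ∀ v ∈ S, v ∉ e})).Reachable u b).card ∧
      (A.filter fun b => ∃ u ∈ Y, (openGraph (ω ∩ {e | ∀ v ∈ S, v ∉ e})).Reachable u b).card ≤ j} with hℓ
  set r : Finset (Fin n) → Fin n → ℝ := fun Y t => μ.real {ω : BondConfig (Fin n) |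
    (∀ u ∈ Y, ¬ (openGraph (ω ∩ {e | ∀ v ∈ S, v ∉ e})).Reachable t u) ∧
      (A.filter fun b => (openGraph (ω ∩ {e | ∀ v ∈ S, v ∉ e})).Reachable t b).card ≤ j} with hr
  set bb : Finset (Fin n) → Fin n → ℝ := fun Y t => μ.real {ω : BondConfig (Fin n) |
    (∃ u ∈ Y, (openGraph (ω ∩ {e | ∀ v ∈ S, v ∉ e})).Reachable t u) ∧
      (A.filter fun b => ∃ u ∈ Y, (openGraph (ω ∩ {e | ∀ v ∈ S, v ∉ e})).Reachable u b).card ≤ j} with hbb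
  set bad : Finset (Fin n) → ℝ := fun Y => μ.real {ω : BondConfig (Fin n) |
    1 ≤ (A.filter fun b => ∃ u ∈ Y, (openGraph (ω ∩ {e | ∀ v ∈ S, v ∉ e})).Reachable u b).card ∧
      (A.filter fun b => ∃ u ∈ Y, (openGraph (ω ∩ {e | ∀ v ∈ S, v ∉ e})).Reachable u b).card ≤ j} with hbad
  set IK : Fin n → ℝ := fun t => μ.real {ω : BondConfig (Fin n) |
    (A.filter fun b => (openGraph (ω ∩ {e | ∀ v ∈ S, v ∉ e})).Reachable t b).card ≤ j} with hIK
  -- flat expansions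
  have hL : μ.real LS = ∑ Y ∈ 𝒴, q Y * ℓ Y c := setL_eq_sum w A S c j hSA hcS 𝒴 h𝒴
  have hR : μ.real RS = ∑ Y ∈ 𝒴, q Y * r Y c := setR_eq_sum w A S c j hcS 𝒴 h𝒴
  -- the per-class gain
  set g : Finset (Fin n) → ℝ := fun Y =>
    if Y = ∅ then IK c else (r Y c + bb Y c) - (r Y (x Y) + bb Y (x Y)) - d Y with hg
  have havg' : 0 ≤ ∑ Y ∈ 𝒴, q Y * g Y := havg
  -- bookkeeping
  have hshift : ∀ Y, ∀ t ∈ A, ℓ Y t + bb Y t = bad Y := fun Y t ht =>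
    setL_add_near w A Y {e | ∀ v ∈ S, v ∉ e} ht j
  have hℓ0 : ∀ t, ℓ ∅ t = 0 := fun t => setL_empty w A {e | ∀ v ∈ S, v ∉ e} t j
  have hr0 : ∀ t, r ∅ t = IK t := fun t => setR_empty w A {e | ∀ v ∈ S, v ∉ e} t j
  -- each class term dominates the gain
  have hterm : ∀ Y ∈ 𝒴, g Y ≤ r Y c - ℓ Y c := by
    intro Y hY
    by_cases hY0 : Y = ∅
    · rw [hY0, hℓ0, hr0]
      simp only [hg, if_true]
      linarith
    · have hne : Y.Nonempty := Finset.nonempty_iff_ne_empty.2 hY0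
      have e1 := hshift Y c hcA
      have e2 := hshift Y (x Y) (hxA Y hY)
      have hWY : ℓ Y (x Y) ≤ r Y (x Y) + d Y := hW Y hY hne
      simp only [hg, hY0, if_false]
      linarith
  have hq0 : ∀ Y ∈ 𝒴, 0 ≤ q Y := fun Y _ => measureReal_nonneg
  have hsum : ∑ Y ∈ 𝒴, q Y * ℓ Y c ≤ ∑ Y ∈ 𝒴, q Y * r Y c := by
    have h1 : ∑ Y ∈ 𝒴, q Y * g Y ≤ ∑ Y ∈ 𝒴, q Y * (r Y c - ℓ Y c) :=
      Finset.sum_le_sum fun Y hY => mul_le_mul_of_nonneg_left (hterm Y hY) (hq0 Y hY)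
    have h2 : ∑ Y ∈ 𝒴, q Y * (r Y c - ℓ Y c) = ∑ Y ∈ 𝒴, q Y * r Y c - ∑ Y ∈ 𝒴, q Y * ℓ Y c := by
      rw [← Finset.sum_sub_distrib]
      exact Finset.sum_congr rfl fun Y _ => by ring
    linarith
  exact (hL.trans_le hsum).trans_eq hR.symm

open TwoGate in
/-- **The QI socket: set-champion stability from per-class references and members (QLM slacks).**  Let `S` be
disjoint from `A`, `c ∈ A`, `𝒴` a finite family carrying the gate set a.s.; for every `Y ∈ 𝒴` let `x_Y ∈ A` be a reference
relay and `y_Y` a member of `Y` (when `Y ≠ ∅`).  With `I_K`, `J^Y` read off `ξ(ω) = ω ∩ {e | ∀ v ∈ S, v ∉ e}` as in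
`setCS_of_classWitnesses`: if
`0 ≤ Σ_{Y ∈ 𝒴} q(Y)·g(Y)`, `g(∅) = I_K(c)`, `g(Y) = J^Y(c) − J^Y(x_Y) − max (I_K(y_Y) − I_K(x_Y)) 0` (`Y ≠ ∅`),
then `CS_w(S, c)`.  The slack of each class is the quantitative lonelier-member lemma
(`CutObserver.observerSet_le_add_posPart`) in the graph with the pairs meeting `S` switched off.
[cite: VandenbergHaggstromKahn2005, Thm. 1.5 (p. 7) — via CutObserver.observerSet_le_add_posPart] -/
theorem setCS_of_classMembers (w : Sym2 (Fin n) → unitInterval) (A S : Finset (Fin n)) (c : Fin n) (j : ℕ)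
    (hSA : Disjoint S A) (hcA : c ∈ A) (𝒴 : Finset (Finset (Fin n)))
    (h𝒴 : (prodBernoulli w).real
      {ω : BondConfig (Fin n) | (Finset.univ.filter fun u => u ∉ S ∧ ∃ v ∈ S, s(u, v) ∈ ω) ∉ 𝒴} = 0)
    (x : Finset (Fin n) → Fin n) (hxA : ∀ Y ∈ 𝒴, x Y ∈ A)
    (y : Finset (Fin n) → Fin n) (hy : ∀ Y ∈ 𝒴, Y.Nonempty → y Y ∈ Y)
    (havg : 0 ≤ ∑ Y ∈ 𝒴,
      (prodBernoulli w).real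
          {ω : BondConfig (Fin n) | (Finset.univ.filter fun u => u ∉ S ∧ ∃ v ∈ S, s(u, v) ∈ ω) = Y} *
        (if Y = ∅ then
          (prodBernoulli w).real {ω : BondConfig (Fin n) |
            (A.filter fun b => (openGraph (ω ∩ {e | ∀ v ∈ S, v ∉ e})).Reachable c b).card ≤ j}
         else
          (((prodBernoulli w).real {ω : BondConfig (Fin n) |
              (∀ u ∈ Y, ¬ (openGraph (ω ∩ {e | ∀ v ∈ S, v ∉ e})).Reachable c u) ∧
                (A.filter fun b => (openGraph (ω ∩ {e | ∀ v ∈ S, v ∉ e})).Reachable c b).card ≤ j} +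
            (prodBernoulli w).real {ω : BondConfig (Fin n) |
              (∃ u ∈ Y, (openGraph (ω ∩ {e | ∀ v ∈ S, v ∉ e})).Reachable c u) ∧
                (A.filter fun b => ∃ u ∈ Y, (openGraph (ω ∩ {e | ∀ v ∈ S, v ∉ e})).Reachable u b).card ≤ j}) -
          ((prodBernoulli w).real {ω : BondConfig (Fin n) |
              (∀ u ∈ Y, ¬ (openGraph (ω ∩ {e | ∀ v ∈ S, v ∉ e})).Reachable (x Y) u) ∧
                (A.filter fun b => (openGraph (ω ∩ {e | ∀ v ∈ S, v ∉ e})).Reachable (x Y) b).card ≤ j} +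
            (prodBernoulli w).real {ω : BondConfig (Fin n) |
              (∃ u ∈ Y, (openGraph (ω ∩ {e | ∀ v ∈ S, v ∉ e})).Reachable (x Y) u) ∧
                (A.filter fun b => ∃ u ∈ Y, (openGraph (ω ∩ {e | ∀ v ∈ S, v ∉ e})).Reachable u b).card ≤ j}) -
          max ((prodBernoulli w).real {ω : BondConfig (Fin n) |
                (A.filter fun b => (openGraph (ω ∩ {e | ∀ v ∈ S, v ∉ e})).Reachable (y Y) b).card ≤ j} -
              (prodBernoulli w).real {ω : BondConfig (Fin n) |
                (A.filter fun b => (openGraph (ω ∩ {e | ∀ v ∈ S, v ∉ e})).Reachable (x Y) b).card ≤ j}) 0)))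
    : (prodBernoulli w).real {ω : BondConfig (Fin n) | (∀ u ∈ S, ω ∉ openConn c u) ∧
        1 ≤ (A.filter fun b => ∃ u ∈ S, ω ∈ openConn u b).card ∧
        (A.filter fun b => ∃ u ∈ S, ω ∈ openConn u b).card ≤ j} ≤
      (prodBernoulli w).real {ω : BondConfig (Fin n) | (∀ u ∈ S, ω ∉ openConn c u) ∧
        (A.filter fun b => ω ∈ openConn c b).card ≤ j} := by
  set D : Set (Sym2 (Fin n)) := {e | ∀ v ∈ S, v ∉ e} with hD
  set w' : Sym2 (Fin n) → unitInterval := fun e => if e ∈ D then w e else 0 with hw'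
  -- transfer of the lightness events to the switched-off weight function
  have hI : ∀ t : Fin n,
      (prodBernoulli w).real {ω : BondConfig (Fin n) |
          (A.filter fun b => (openGraph (ω ∩ {e | ∀ v ∈ S, v ∉ e})).Reachable t b).card ≤ j} =
        (prodBernoulli w').real {ω : BondConfig (Fin n) | (A.filter fun b => ω ∈ openConn t b).card ≤ j} := by
    intro t
    have h := measureReal_preimage_off w D
      {ω : BondConfig (Fin n) | (A.filter fun b => ω ∈ openConn t b).card ≤ j}
    have hset : {ω : BondConfig (Fin n) | ω ∩ D ∈
        {ω : BondConfig (Fin n) | (A.filter fun b => ω ∈ openConn t b).card ≤ j}} =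
        {ω : BondConfig (Fin n) |
          (A.filter fun b => (openGraph (ω ∩ {e | ∀ v ∈ S, v ∉ e})).Reachable t b).card ≤ j} := by
      ext ω; simp only [hD, mem_setOf_eq, mem_openConn_iff']
    rw [hset] at h
    exact h
  refine setCS_of_classDeficiencies w A S c j hSA hcA 𝒴 h𝒴 x hxA
    (fun Y => max ((prodBernoulli w).real {ω : BondConfig (Fin n) |
        (A.filter fun b => (openGraph (ω ∩ {e | ∀ v ∈ S, v ∉ e})).Reachable (y Y) b).card ≤ j} -
      (prodBernoulli w).real {ω : BondConfig (Fin n) |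
        (A.filter fun b => (openGraph (ω ∩ {e | ∀ v ∈ S, v ∉ e})).Reachable (x Y) b).card ≤ j}) 0) ?_ havg
  intro Y hY hne
  -- the quantitative lonelier-member lemma in the switched-off graph, at the member `y Y` and reference `x Y`
  have key := observerSet_le_add_posPart w' A Y (y Y) (x Y) (hy Y hY hne) j
  have hL := measureReal_preimage_off w D
    {ω : BondConfig (Fin n) | (∀ u ∈ Y, ω ∉ openConn (x Y) u) ∧
      1 ≤ (A.filter fun b => ∃ u ∈ Y, ω ∈ openConn u b).card ∧
      (A.filter fun b => ∃ u ∈ Y, ω ∈ openConn u b).card ≤ j}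
  have hsetL : {ω : BondConfig (Fin n) | ω ∩ D ∈
      {ω : BondConfig (Fin n) | (∀ u ∈ Y, ω ∉ openConn (x Y) u) ∧
        1 ≤ (A.filter fun b => ∃ u ∈ Y, ω ∈ openConn u b).card ∧
        (A.filter fun b => ∃ u ∈ Y, ω ∈ openConn u b).card ≤ j}} =
      {ω : BondConfig (Fin n) |
        (∀ u ∈ Y, ¬ (openGraph (ω ∩ {e | ∀ v ∈ S, v ∉ e})).Reachable (x Y) u) ∧
          1 ≤ (A.filter fun b => ∃ u ∈ Y, (openGraph (ω ∩ {e | ∀ v ∈ S, v ∉ e})).Reachable u b).card ∧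
          (A.filter fun b => ∃ u ∈ Y, (openGraph (ω ∩ {e | ∀ v ∈ S, v ∉ e})).Reachable u b).card ≤ j} := by
    ext ω; simp only [hD, mem_setOf_eq, mem_openConn_iff']
  rw [hsetL] at hL
  have hR := measureReal_preimage_off w D
    {ω : BondConfig (Fin n) | (∀ u ∈ Y, ω ∉ openConn (x Y) u) ∧ (A.filter fun b => ω ∈ openConn (x Y) b).card ≤ j}
  have hsetR : {ω : BondConfig (Fin n) | ω ∩ D ∈
      {ω : BondConfig (Fin n) | (∀ u ∈ Y, ω ∉ openConn (x Y) u) ∧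
        (A.filter fun b => ω ∈ openConn (x Y) b).card ≤ j}} =
      {ω : BondConfig (Fin n) |
        (∀ u ∈ Y, ¬ (openGraph (ω ∩ {e | ∀ v ∈ S, v ∉ e})).Reachable (x Y) u) ∧
          (A.filter fun b => (openGraph (ω ∩ {e | ∀ v ∈ S, v ∉ e})).Reachable (x Y) b).card ≤ j} := by
    ext ω; simp only [hD, mem_setOf_eq, mem_openConn_iff']
  rw [hsetR] at hR
  rw [hL, hR, hI (y Y), hI (x Y)]
  convert key using 3

end SetStar

end CutObserver

end Summit.CriticalPhenomena.PercolationContinuityZ3.Theorems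

end
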